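import Summits.HodgeConjecture.HodgeConjecture.Theorems.R90S6EtaGraphTwoPartner       -- ★ W10-a (E.5) part 2 (p02): η̂ = `etaGraphTwoPartnerAlgHom`, graph, uniqueness, `_one`
import Summits.HodgeConjecture.HodgeConjecture.Theorems.R90S6GLTwoPieri                -- ★ W10-j FILE A (p02): `GL₂` Pieri `r = 1` with explicit counts, central shift
import Summits.HodgeConjecture.HodgeConjecture.Theorems.R90S6BCPartnerOnGenerators     -- ★ W10-c (G.0) `glHeckeEigencharacter_heckeDiag` (p06, generic `n`)
import Summits.HodgeConjecture.HodgeConjecture.Theorems.R90S6MacdonaldRankOneU2        -- ★ W8-g′ (p03): `eq_basic_two`, brings ★ `heckeEigencharacter_doubleCosetOperator_basic_two`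
import HarnessLib

/-!
# R90 · S6 «Ch. 14.1–14.5 stable TF» — WAVE 10 card W10-j, FILE B: `η̂` (RANK 2) ON THE GENERATORS AND THE PIERI RECURSION FOR `E_a = η̂(c_{(a,0)})`
# (`Theorems/R90S6EtaTwoPartnerOnBasis.lean`; row E1.4.4.3.2 «η̂_j-clauses for every φ_v ∈ ℋ(GL₂(L_w)) — expansion in the U(2) basis»)

Cell `hodgecm-mathlib`, crux H413 (`stmt-HodgeConjecture-24833`), route of record `HCCMUnconditional`; programme R90-TF, section S6 (base `R90-C14`),
seat R90-C14-p02 (g2); S6 dealer R90-C14-plan (g2) CARD W10-j (R90 bus 2026-09-05T01:37:25Z).  Lane `--supports stmt-HodgeConjecture-24833 --as helper`; THEOREMS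
ONLY; letters = ★ (E.5) part 2 VERBATIM (`c hc1 v w hw hv`, `K` DVR-valued, `hϖ`, `hu : u² = #𝓀[K]`, `hwt` at `n = 2`) + ★ p03 (`hd`, `t`, `ht`, `φ′_k = doubleCosetOperator K₀ (t^k)`,
`q = Nat.sqrt #𝓀[E_w]`) + ★ FILE A (`c_ν = doubleCosetOperator (glInt 2 K) (zpowDiagGL hϖ.ne_zero ν)`, `T_r`, `q_K = #𝓀[K]`).

THE JUNCTION PIN `huq : (u : ℂ) = Nat.sqrt #𝓀[E_w]`.  ★ (G.0) at `n = 2`: `λ^{wt}_{(z,z⁻¹)}(T₁) = u·(z + z⁻¹)` — the `δ^{1∕2}` square root `u` is a SIGN CHOICE; with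
`u = −q` the partner is the `τ`-conjugate (★ W10-i: `η̂_{−u} = τ ∘ η̂_u`).  (J.1) is stated under `huq` (`u = +q_v`, dischargeable at `K := L_w` by choosing `u := q_v`,
`hu` then by ★ `hd.sqrt_card_residueField_mul_self` + ★ `natCard_residueField_eq_of_compatible`); (J.1b), (J.2), (J.3) need no pin.

CONTENT (`E_a := η̂(c_{(a,0)})`):
* §1 (J.0) the `GL₂` line values `λ^{wt}_{(z,z⁻¹)}(T₁) = u(z + z⁻¹)`, `λ^{wt}_{(z,z⁻¹)}(T₂) = 1` (★ (G.0) at `n = 2`);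
* §2 (J.1) **`etaGraphTwoPartnerAlgHom_heckeDiag_one`**: `η̂ T₁ = φ′₁ + (−((q−1 : ℕ) : ℂ)) • 1` under `huq` (U(2) side ★ `heckeEigencharacter_doubleCosetOperator_basic_two`:
  `λ_{(z,1)}(φ′₁) = q(z+z⁻¹) + (q − 1)`; additive spelling — carrier `Sub`∕`map_sub` are Ring-path heartbeat sinks); (J.1b) **`etaGraphTwoPartnerAlgHom_heckeDiag_two`**: `η̂ T₂ = 1`;
* §3 (J.2) **CENTRAL COLLAPSE** `etaGraphTwoPartnerAlgHom_zpowDiagGL_add_one`: `η̂ c_{ν+𝟙} = η̂ c_ν` (★ FILE A (P.0) + (J.1b)); so `E` depends on `a − b` only;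
* §4 (J.3) **THE RECURSION** `etaGraphTwoPartnerAlgHom_pieri`: `E_a · η̂T₁ = E_{a+1} + ((q_K + [a = 1] : ℕ) : ℂ) • E_{a−1}` (`a ≥ 1`; ★ FILE A (P.1) through `η̂`, (J.2));
  `E₀ = 1` (`etaGraphTwoPartnerAlgHom_zpowDiagGL_zero`).  With (J.1) this determines every `E_a` in `ℋ(U(J₀,2)(E_w), K₀)`; the closed ∕ shell form in the
  `φ′`-basis is FILE C (`R90S6EtaTwoPartnerClosedForm`).
KILL-CHECKS (graph at `z`, `u = q`): `E₁ = φ′₁ − (q−1)`: `q(z+z⁻¹) + q − 1 − (q−1) = q(z+z⁻¹)` ✓; `E₂ = E₁(φ′₁ − (q−1)) − (Q+1)`: eigenvalue `q²(z+z⁻¹)² − q² − 1 =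
q²(z²+z⁻²) + q² − 1` = `λ(φ′₂) − (q−1)λ(φ′₁) + q² − q` ✓ (`E₂ = φ′₂ − (q−1)φ′₁ + (q²−q)•1`).
HONEST LABEL: local Hecke bookkeeping; proves no orbital-integral identity and no printed global statement; count-neutral until E1.4.4.3.2 consumes it.  HC_CM is proved
only modulo the 7 printed citations (2 remaining named inputs: hLiu418 = stmt-HodgeConjecture-24832, h413 = stmt-HodgeConjecture-24833) until rung 0 closes; REL ≠ ★ ≠ BUILT.

## References
* [Rogawski1990] J. D. Rogawski, *Automorphic Representations of Unitary Groups in Three Variables*, Ann. of Math. Stud. 123 (1990), §4.11 Prop. 4.11.1 p. 58 (`η̂` for `H = U(2)`),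
  §4.9 p. 55.
* [Macdonald1971] I. G. Macdonald, *Spherical functions on a group of p-adic type* (1971), Ch. V §3.
* [ShimuraIATAF1971] G. Shimura, *Introduction to the arithmetic theory of automorphic functions* (1971), Thm. 3.21, Thm. 3.24.
* [CartierCorvallis1979] P. Cartier, *Representations of 𝔭-adic groups: a survey*, PSPM 33.1 (1979), §IV (4.2), Cor. 4.2.
-/

set_option autoImplicit false
-- the mandated namespace repeats the single-problem summit's segment (`HodgeConjecture.HodgeConjecture`)
set_option linter.dupNamespace false

noncomputable section

open NumberField IsDedekindDomain
open Literature.NumberTheory.Automorphic Literature.NumberTheory.Automorphic.HermitianLattice Literature.NumberTheory.Automorphic.UnitaryGroup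
open Literature.NumberTheory.Automorphic.CartanUnique
open scoped MatrixGroups
open ValuativeRel Finset

namespace Summit.HodgeConjecture.HodgeConjecture.R90.S6

universe u

/-! ## §0 Light-carrier bookkeeping (instantiated at the Hecke algebras by unification only) -/

/-- `f x = f z` from `x = y · z` and `f y = 1`. [folklore] -/
private theorem algHom_apply_eq_of_eq_mul_of_map_eq_one {R A B : Type*} [CommSemiring R] [Semiring A] [Semiring B] [Algebra R A] [Algebra R B]
    (f : A →ₐ[R] B) {x y z : A} (h : x = y * z) (hy : f y = 1) : f x = f z := by
  rw [h, map_mul, hy, one_mul]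

/-- `f x · f y = f z + b • f v` from `x · y = z + b • v`. [folklore] -/
private theorem algHom_mul_of_eq_add_smul {R A B : Type*} [CommSemiring R] [Semiring A] [Semiring B] [Algebra R A] [Algebra R B]
    (f : A →ₐ[R] B) {x y z v : A} {b : R} (h : x * y = z + b • v) : f x * f y = f z + b • f v := by
  rw [← map_mul, h, map_add, map_smul]

/-! ## §1 (J.0) The `GL₂` line values at `zz = (z, z⁻¹)` -/

section LineValues

/-- `e₁(z, z⁻¹) = z + z⁻¹` in the engine's `powersetCard` form. [folklore] -/
private theorem sum_powersetCard_one_etaLine (z : ℂˣ) :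
    (∑ t ∈ powersetCard 1 (univ : Finset (Fin 2)), ∏ i ∈ t, (((![z, z⁻¹] : Fin 2 → ℂˣ) i : ℂˣ) : ℂ)) = (z : ℂ) + (z : ℂ)⁻¹ := by
  rw [powersetCard_one_univ_fin_two, Finset.sum_insert (by decide), Finset.sum_singleton, Finset.prod_singleton, Finset.prod_singleton]
  simp only [Matrix.cons_val_zero, Matrix.cons_val_one, Matrix.cons_val_fin_one, Units.val_inv_eq_inv_val]

/-- `e₂(z, z⁻¹) = z·z⁻¹ = 1` in the engine's `powersetCard` form. [folklore] -/
private theorem sum_powersetCard_two_etaLine (z : ℂˣ) :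
    (∑ t ∈ powersetCard 2 (univ : Finset (Fin 2)), ∏ i ∈ t, (((![z, z⁻¹] : Fin 2 → ℂˣ) i : ℂˣ) : ℂ)) = 1 := by
  rw [powersetCard_two_univ_fin_two, Finset.sum_singleton, Finset.prod_insert (by decide), Finset.prod_singleton]
  simp only [Matrix.cons_val_zero, Matrix.cons_val_one, Matrix.cons_val_fin_one, Units.val_inv_eq_inv_val, mul_inv_cancel₀ z.ne_zero]

variable {K : Type u} [Field K] [ValuativeRel K] [IsDiscreteValuationRing 𝒪[K]] [Finite 𝓀[K]] {ϖ : K}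
  [IsHeckeTriple (⊤ : Submonoid (GL (Fin 2) K)) (glInt 2 K) (glInt 2 K)]
  (hϖ : IsUniformizingElement ϖ) {u : ℂˣ} (hu : (u : ℂ) ^ 2 = ((Nat.card 𝓀[K] : ℕ) : ℂ))
  {wt : Multiplicative (Fin 2 → ℤ) →* ℂ}
  (hwt : ∀ e : Fin 2 → ℤ, wt (Multiplicative.ofAdd e) = ((u ^ ((((2 : ℕ) : ℤ) - 1) * (∑ i, e i) - 2 * satakeTwistExp e) : ℂˣ) : ℂ))

include hu hwt

/-- **(J.0) `λ^{GL₂}_{(z,z⁻¹)}(T₁) = u·(z + z⁻¹)`** (★ (G.0) at `n = 2`, `r = 1`; `u² = q_K`: the `δ^{1∕2}` square root IS the coefficient). [cite: ShimuraIATAF1971, Thm. 3.21] -/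
theorem glHeckeEigencharacter_etaLine_heckeDiag_one (z : ℂˣ) :
    (isIwasawaExponent_gl hϖ).heckeEigencharacter wt (laurentMonomialHom ![z, z⁻¹])
        (heckeAlgebra.doubleCosetOperator (glInt 2 K) (heckeDiag 2 (Units.mk0 ϖ hϖ.ne_zero) 1)) = (u : ℂ) * ((z : ℂ) + (z : ℂ)⁻¹) := by
  rw [glHeckeEigencharacter_heckeDiag (n := 2) hϖ hu hwt ![z, z⁻¹] (r := 1) (by norm_num), sum_powersetCard_one_etaLine,
    show (((2 : ℕ) : ℤ) - 1) * ((1 : ℕ) : ℤ) = ((1 : ℕ) : ℤ) by norm_num, zpow_natCast, pow_one]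
  norm_num

/-- **(J.0) `λ^{GL₂}_{(z,z⁻¹)}(T₂) = 1`** (`T₂` central: `q_K⁻¹ u² · z z⁻¹ = 1`). [cite: ShimuraIATAF1971, Thm. 3.21] -/
theorem glHeckeEigencharacter_etaLine_heckeDiag_two (z : ℂˣ) :
    (isIwasawaExponent_gl hϖ).heckeEigencharacter wt (laurentMonomialHom ![z, z⁻¹])
        (heckeAlgebra.doubleCosetOperator (glInt 2 K) (heckeDiag 2 (Units.mk0 ϖ hϖ.ne_zero) 2)) = 1 := by
  have hq : ((Nat.card 𝓀[K] : ℕ) : ℂ) ≠ 0 := natCard_residueField_ne_zero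
  rw [glHeckeEigencharacter_heckeDiag (n := 2) hϖ hu hwt ![z, z⁻¹] (r := 2) le_rfl, sum_powersetCard_two_etaLine,
    show (((2 : ℕ) : ℤ) - 1) * ((2 : ℕ) : ℤ) = ((2 : ℕ) : ℤ) by norm_num, zpow_natCast, Units.val_pow_eq_pow_val, hu]
  field_simp
  norm_num

end LineValues

section Partner

variable {F E : Type} [Field F] [NumberField F] [Field E] [NumberField E] [Algebra F E] [Algebra.IsQuadraticExtension F E]
  (c : E ≃ₐ[F] E) (hc1 : c ≠ 1) (v : HeightOneSpectrum (𝓞 F)) (w : PlacesOver E v) (hw : c • w.1 = w.1)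
  (hv : Algebra.IsUnramifiedIn (𝓞 E) v.asIdeal)
  {K : Type u} [Field K] [ValuativeRel K] [IsDiscreteValuationRing 𝒪[K]] [Finite 𝓀[K]] {ϖ : K}
  [IsHeckeTriple (⊤ : Submonoid (GL (Fin 2) K)) (glInt 2 K) (glInt 2 K)]
  (hϖ : IsUniformizingElement ϖ) {u : ℂˣ} (hu : (u : ℂ) ^ 2 = ((Nat.card 𝓀[K] : ℕ) : ℂ))
  {wt : Multiplicative (Fin 2 → ℤ) →* ℂ}
  (hwt : ∀ e : Fin 2 → ℤ, wt (Multiplicative.ofAdd e) = ((u ^ ((((2 : ℕ) : ℤ) - 1) * (∑ i, e i) - 2 * satakeTwistExp e) : ℂˣ) : ℂ))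

/-! ## §2 (J.1) `η̂` on the generators `T₁`, `T₂` -/

/-- **(J.1) `η̂ T₁ = φ′₁ − (q − 1)•1`**, spelled additively `φ′₁ + (−((q−1 : ℕ) : ℂ)) • 1` (`φ′₁ = 1_{K₀ t K₀}`, `t = diag(ϖ′, ϖ′⁻¹)`, `q = Nat.sqrt #𝓀[E_w]`), under the junction pin
`huq : u = q` (see the module docstring): both sides of the graph equal `q(z + z⁻¹)` ((J.0) and ★ `heckeEigencharacter_doubleCosetOperator_basic_two`).
[cite: Rogawski1990, §4.11 Prop. 4.11.1 p. 58] [cite: Macdonald1971, Ch. V §3] [cite: CartierCorvallis1979, §IV Cor. 4.2] -/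
theorem etaGraphTwoPartnerAlgHom_heckeDiag_one {ϖ' : w.1.adicCompletion E} (hd : UnramifiedLocalConjDatum (galAdicCompletionMap (L := E) c hw) ϖ')
    (t : ↥(unitaryGroupOfForm (galAdicCompletionMap (L := E) c hw) ((StdForm.antidiagonal 2).over (w.1.adicCompletion E))))
    (ht : (t : GL (Fin 2) (w.1.adicCompletion E)) = zpowDiagGL (uniformizer_ne_zero hd.vϖ) ![(1 : ℤ), -1])
    (huq : (u : ℂ) = (Nat.sqrt (Nat.card (Valued.ResidueField (w.1.adicCompletion E))) : ℂ)) :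
    haveI := isHeckeTriple_unitaryInt_adicCompletion c v w hw ((StdForm.antidiagonal 2).over (w.1.adicCompletion E))
    etaGraphTwoPartnerAlgHom c hc1 v w hw hv hϖ hu hwt (heckeAlgebra.doubleCosetOperator (glInt 2 K) (heckeDiag 2 (Units.mk0 ϖ hϖ.ne_zero) 1)) =
      heckeAlgebra.doubleCosetOperator (k := ℂ) (unitaryInt (galAdicCompletionMap (L := E) c hw) ((StdForm.antidiagonal 2).over (w.1.adicCompletion E))) t +
        (-(((Nat.sqrt (Nat.card (Valued.ResidueField (w.1.adicCompletion E))) - 1 : ℕ)) : ℂ)) • 1 := by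
  haveI := isHeckeTriple_unitaryInt_adicCompletion c v w hw ((StdForm.antidiagonal 2).over (w.1.adicCompletion E))
  haveI := finite_residueField_adicCompletion E w.1
  have hσ := exists_galAdicCompletionMap_ne c hc1 v w hw
  -- `q ≥ 1`, so `((q − 1 : ℕ) : ℂ) = q − 1`
  have hq1 : (((Nat.sqrt (Nat.card (Valued.ResidueField (w.1.adicCompletion E))) - 1 : ℕ)) : ℂ) =
      (Nat.sqrt (Nat.card (Valued.ResidueField (w.1.adicCompletion E))) : ℂ) - 1 := by
    haveI : Nonempty (Valued.ResidueField (w.1.adicCompletion E)) := ⟨0⟩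
    rw [Nat.cast_sub (Nat.succ_le_of_lt (Nat.sqrt_pos.2 Nat.card_pos)), Nat.cast_one]
  refine (eq_etaGraphTwoPartnerAlgHom_of_graph c hc1 v w hw hv hϖ hu hwt _ _ fun z => ?_).symm
  -- `λ_{(z,1)}(φ′₁) = q(z + z⁻¹) + (q − 1)` (★ basic value, read through the datum `hd`; `t` IS the basic element by ★ `eq_basic_two`)
  have hφ : unitaryHeckeEigencharacterAdic c hc1 v w hw hv ![z, 1]
      (heckeAlgebra.doubleCosetOperator (k := ℂ) (unitaryInt (galAdicCompletionMap (L := E) c hw) ((StdForm.antidiagonal 2).over (w.1.adicCompletion E))) t) =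
      (Nat.sqrt (Nat.card (Valued.ResidueField (w.1.adicCompletion E))) : ℂ) * ((z : ℂ) + (z : ℂ)⁻¹) +
        ((Nat.sqrt (Nat.card (Valued.ResidueField (w.1.adicCompletion E))) : ℂ) - 1) := by
    have h := (DFunLike.congr_fun (unitaryHeckeEigencharacterAdic_eq c hc1 v w hw hv hd ![z, 1]) _).trans
      ((congrArg (fun s => hd.heckeEigencharacter ![z, 1] (heckeAlgebra.doubleCosetOperator (k := ℂ)
        (unitaryInt (galAdicCompletionMap (L := E) c hw) ((StdForm.antidiagonal 2).over (w.1.adicCompletion E))) s)) (eq_basic_two hd t ht)).trans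
        (hd.heckeEigencharacter_doubleCosetOperator_basic_two hσ ![z, 1]))
    have hz : (((![z, 1] : Fin 2 → ℂˣ) 0 : ℂˣ) : ℂ) * ((((![z, 1] : Fin 2 → ℂˣ) 1 : ℂˣ) : ℂ))⁻¹ = z := by simp
    rw [hz] at h
    exact h
  have hs : ∀ (r : ℂ) x, unitaryHeckeEigencharacterAdic c hc1 v w hw hv ![z, 1] (r • x) = r • unitaryHeckeEigencharacterAdic c hc1 v w hw hv ![z, 1] x :=
    fun r x => (unitaryHeckeEigencharacterAdic c hc1 v w hw hv ![z, 1]).toLinearMap.map_smul r x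
  have hone := (unitaryHeckeEigencharacterAdic c hc1 v w hw hv ![z, 1]).toRingHom.map_one
  refine (glHeckeEigencharacter_etaLine_heckeDiag_one hϖ hu hwt z).trans (Eq.trans ?_
    (((unitaryHeckeEigencharacterAdic c hc1 v w hw hv ![z, 1]).toRingHom.map_add _ _).trans
      (congrArg₂ (· + ·) hφ ((hs _ 1).trans (congrArg (_ • ·) hone)))).symm)
  rw [smul_eq_mul, mul_one, hq1, huq]
  ring

/-- **(J.1b) `η̂ T₂ = 1`**: the central operator has eigencharacter `1` on the line `(z, z⁻¹)` ((J.0)) and `λ^{U(2)}(1) = 1`; no pin needed.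
[cite: Rogawski1990, §4.11 Prop. 4.11.1 p. 58] -/
theorem etaGraphTwoPartnerAlgHom_heckeDiag_two :
    etaGraphTwoPartnerAlgHom c hc1 v w hw hv hϖ hu hwt (heckeAlgebra.doubleCosetOperator (glInt 2 K) (heckeDiag 2 (Units.mk0 ϖ hϖ.ne_zero) 2)) = 1 :=
  (eq_etaGraphTwoPartnerAlgHom_of_graph c hc1 v w hw hv hϖ hu hwt _ _ fun z => by
    rw [glHeckeEigencharacter_etaLine_heckeDiag_two hϖ hu hwt, map_one]).symm

/-! ## §3 (J.2) Central collapse -/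

/-- **(J.2) CENTRAL COLLAPSE `η̂ c_{ν+𝟙} = η̂ c_ν`**: `c_{ν+𝟙} = T₂ · c_ν` (★ FILE A (P.0)) and `η̂ T₂ = 1`; so `η̂ c_{(a,b)}` depends on `a − b` only.
[cite: Rogawski1990, §4.11 p. 58] [cite: ShimuraIATAF1971, Prop. 3.17] -/
theorem etaGraphTwoPartnerAlgHom_zpowDiagGL_add_one (ν : Fin 2 → ℤ) :
    etaGraphTwoPartnerAlgHom c hc1 v w hw hv hϖ hu hwt (heckeAlgebra.doubleCosetOperator (glInt 2 K) (zpowDiagGL hϖ.ne_zero (ν + 1))) =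
      etaGraphTwoPartnerAlgHom c hc1 v w hw hv hϖ hu hwt (heckeAlgebra.doubleCosetOperator (glInt 2 K) (zpowDiagGL hϖ.ne_zero ν)) :=
  algHom_apply_eq_of_eq_mul_of_map_eq_one _ (doubleCosetOperator_zpowDiagGL_add_one_two (k := ℂ) hϖ ν)
    (etaGraphTwoPartnerAlgHom_heckeDiag_two c hc1 v w hw hv hϖ hu hwt)

/-- `η̂ c_{(a,1)} = η̂ c_{(a−1,0)}` (`a ≥ 1`). [cite: Rogawski1990, §4.11 p. 58] -/
theorem etaGraphTwoPartnerAlgHom_zpowDiagGL_pair_one {a : ℕ} (ha : 1 ≤ a) :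
    etaGraphTwoPartnerAlgHom c hc1 v w hw hv hϖ hu hwt (heckeAlgebra.doubleCosetOperator (glInt 2 K) (zpowDiagGL hϖ.ne_zero ![(a : ℤ), 1])) =
      etaGraphTwoPartnerAlgHom c hc1 v w hw hv hϖ hu hwt (heckeAlgebra.doubleCosetOperator (glInt 2 K) (zpowDiagGL hϖ.ne_zero ![((a - 1 : ℕ) : ℤ), 0])) :=
  algHom_apply_eq_of_eq_mul_of_map_eq_one _ (doubleCosetOperator_zpowDiagGL_pair_one_two (k := ℂ) hϖ ha)
    (etaGraphTwoPartnerAlgHom_heckeDiag_two c hc1 v w hw hv hϖ hu hwt)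

/-- `E₀ = η̂ c_0 = 1`. [cite: Rogawski1990, §4.11 Prop. 4.11.1 (a) p. 58] -/
theorem etaGraphTwoPartnerAlgHom_zpowDiagGL_zero :
    etaGraphTwoPartnerAlgHom c hc1 v w hw hv hϖ hu hwt (heckeAlgebra.doubleCosetOperator (glInt 2 K) (zpowDiagGL hϖ.ne_zero ![((0 : ℕ) : ℤ), 0])) = 1 := by
  rw [show (![((0 : ℕ) : ℤ), 0] : Fin 2 → ℤ) = 0 from by funext i; fin_cases i <;> rfl, doubleCosetOperator_zpowDiagGL_zero_two hϖ,
    etaGraphTwoPartnerAlgHom_one]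

/-! ## §4 (J.3) The Pieri recursion for `E_a = η̂ c_{(a,0)}` -/

/-- **(J.3) THE RECURSION `E_a · η̂T₁ = E_{a+1} + (q_K + [a = 1]) • E_{a−1}`** (`a ≥ 1`, `E_a = η̂ c_{(a,0)}`, `q_K = #𝓀[K]`): ★ FILE A (P.1) through the algebra
homomorphism `η̂` and the central collapse (J.2) (`η̂ c_{(a,1)} = E_{a−1}`).  With (J.1) (`η̂T₁ = φ′₁ − (q−1)`) and `E₀ = 1` it determines every `E_a`.
[cite: Rogawski1990, §4.11 p. 58] [cite: Macdonald1995, Ch. V (2.6)] [cite: ShimuraIATAF1971, Thm. 3.24] -/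
theorem etaGraphTwoPartnerAlgHom_pieri {a : ℕ} (ha : 1 ≤ a) :
    etaGraphTwoPartnerAlgHom c hc1 v w hw hv hϖ hu hwt (heckeAlgebra.doubleCosetOperator (glInt 2 K) (zpowDiagGL hϖ.ne_zero ![(a : ℤ), 0])) *
        etaGraphTwoPartnerAlgHom c hc1 v w hw hv hϖ hu hwt (heckeAlgebra.doubleCosetOperator (glInt 2 K) (heckeDiag 2 (Units.mk0 ϖ hϖ.ne_zero) 1)) =
      etaGraphTwoPartnerAlgHom c hc1 v w hw hv hϖ hu hwt (heckeAlgebra.doubleCosetOperator (glInt 2 K) (zpowDiagGL hϖ.ne_zero ![(a : ℤ) + 1, 0])) +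
        ((Nat.card 𝓀[K] + (if a = 1 then 1 else 0) : ℕ) : ℂ) •
          etaGraphTwoPartnerAlgHom c hc1 v w hw hv hϖ hu hwt (heckeAlgebra.doubleCosetOperator (glInt 2 K) (zpowDiagGL hϖ.ne_zero ![((a - 1 : ℕ) : ℤ), 0])) :=
  (algHom_mul_of_eq_add_smul _ (doubleCosetOperator_zpowDiagGL_mul_heckeDiag_one_two (k := ℂ) hϖ ha)).trans
    (congrArg (_ + _ • ·) (etaGraphTwoPartnerAlgHom_zpowDiagGL_pair_one c hc1 v w hw hv hϖ hu hwt ha))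

end Partner

end Summit.HodgeConjecture.HodgeConjecture.R90.S6

end
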